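import Summits.ResolutionOfSingularities.ResolutionOfSingularities.Theorems.FrobeniusLadderFRationalResolutionIntrinsicRecipe
import Summits.ResolutionOfSingularities.ResolutionOfSingularities.Theorems.FrobeniusLadderFRationalResolutionGaloisCharacteristicCentreGlobal
import HarnessLib

/-!
# Crux `FrobeniusLadder.FRationalResolution` (stmt-ResolutionOfSingularities-15317), line `redirect`,
# stub `stub_diagonalizableQuotientResolution` — THE INTRINSIC TWO-STEP RECIPE, SCHEME SIDE: finitely many twisted isolated points, each with a
# characteristic first centre whose blowing up has isolated singular points resolved by one point blow-up ⇒ `Scheme.HasResolution X`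
# (global form of the capstone `…IntrinsicRecipe.hloc_of_characteristic_then_singularPoints`, p839630, through the tree's `IsolatedGlue`)

This is `…GaloisCharacteristicCentreGlobal.hasResolution_of_characteristic_ideals_adicCompletion` (p838474) with the per-point hypothesis «`Bl_J(Spec Ê)` regular»
replaced by the two-step data of this generation: a proper characteristic `J₁ ⊇ (𝔔'Ê)ⁿ`, `Sing Bl_{J₁}(Spec Ê)` closed and consisting of closed points, and
`Bl_{𝔪_z}(Spec 𝒪_{X₁,z})` regular at each of them (e.g. the naive recipe `J₁ = 𝔪̂ᵃ`, or the class-group centre `J₁ = 𝔞_totᴺ`).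

* ★★★ `hasResolution_of_characteristic_then_singularPoints`.

Honest label: assembly toward ONE leaf stub (no stub, crux or summit closed): an integral variety over any field whose finitely many singular points are twisted
isolated points carrying these data HAS A RESOLUTION; producing the data from the stub's hypothesis `hq` is the remaining (α′)/(β) work of MEMO-15317-leafhand2-g17 §3.
No definitions, no named facts, no sorry. [cite: StacksProject, Tag 080B; Tag 0CDQ; Tag 09EB] [cite: Kollar2007, §2.2] [cite: Matsumura1987, Thm. 8.11; Thm. 8.14]
-/

noncomputable section

-- single-problem summit: the doubled namespace component is forced
set_option linter.dupNamespace false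

open CategoryTheory CategoryTheory.Limits AlgebraicGeometry TopologicalSpace TensorProduct IsLocalRing
open Literature.AlgebraicGeometry.Resolution
open Summit.ResolutionOfSingularities.ResolutionOfSingularities.Theorems.FRationalResolution

namespace Summit.ResolutionOfSingularities.ResolutionOfSingularities.Theorems.FRationalResolution.IntrinsicRecipeGlobal

/-- ★★★ **Characteristic first centres with point-resolvable isolated singularities, at finitely many twisted points, resolve.**
[cite: StacksProject, Tag 080B; Tag 0CDQ; Tag 09EB] [cite: Kollar2007, §2.2] [cite: Matsumura1987, Thm. 8.11; Thm. 8.14] -/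
theorem hasResolution_of_characteristic_then_singularPoints (K : Type) [Field K] (X : Scheme.{0}) [IsIntegral X]
    (f : X ⟶ Spec (.of K)) [LocallyOfFiniteType f] (hfin : (Scheme.regularLocus X)ᶜ.Finite)
    (hchart : ∀ s : X, s ∉ Scheme.regularLocus X →
      ∃ (B : Type) (_ : CommRing B) (_ : IsDomain B) (_ : Algebra K B) (_ : Algebra.FiniteType K B)
        (ι : Spec (.of B) ⟶ X) (_ : IsOpenImmersion ι)
        (_ : ι ≫ f = Spec.map (CommRingCat.ofHom (algebraMap K B)))
        (𝔭 : Ideal B) (h𝔭 : 𝔭.IsMaximal) (_ : 𝔭 ≠ ⊥) (_ : ι ⟨𝔭, h𝔭.isPrime⟩ = s)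
        (_ : ∀ P : Spec (.of B), P.asIdeal ≠ 𝔭 → P ∈ Scheme.regularLocus (Spec (.of B)))
        (K' : Type) (_ : Field K') (_ : Algebra K K') (_ : FiniteDimensional K K') (_ : IsGalois K K')
        (𝔔' : Ideal (B ⊗[K] K')) (_ : 𝔔'.IsMaximal)
        (J₁ : Ideal (AdicCompletion (maximalIdeal (Localization.AtPrime 𝔔')) (Localization.AtPrime 𝔔')))
        (n : ℕ) (_ : IsClosed (Scheme.regularLocus (affineBlowup J₁))ᶜ),
          𝔔'.comap (algebraMap B (B ⊗[K] K')) = 𝔭 ∧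
          𝔔'.map (algebraMap (B ⊗[K] K')
            (AdicCompletion (maximalIdeal (Localization.AtPrime 𝔔')) (Localization.AtPrime 𝔔'))) ^ n ≤ J₁ ∧
          J₁ ≠ ⊤ ∧
          (∀ θ : AdicCompletion (maximalIdeal (Localization.AtPrime 𝔔')) (Localization.AtPrime 𝔔') ≃+*
              AdicCompletion (maximalIdeal (Localization.AtPrime 𝔔')) (Localization.AtPrime 𝔔'), J₁.map (θ : _ →+* _) ≤ J₁) ∧
          (∀ z ∈ (Scheme.regularLocus (affineBlowup J₁))ᶜ, IsClosed ({z} : Set (affineBlowup J₁))) ∧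
          (∀ z ∈ (Scheme.regularLocus (affineBlowup J₁))ᶜ,
            Scheme.IsRegular (affineBlowup (maximalIdeal ((affineBlowup J₁).presheaf.stalk z))))) :
    Scheme.HasResolution X := by
  refine IsolatedGlue.hasResolution_of_finite_singularLocus_of_local K X f hfin fun s hs => ?_
  obtain ⟨B, _, _, _, _, ι, _, hι, 𝔭, h𝔭, h𝔭0, hιs, hregB, K', _, _, _, _, 𝔔', _, J₁, n, hZc, h𝔔'𝔭, hn, hJ₁top, hchar, hpt, hloc⟩ :=
    hchart s hs
  subst hιs
  exact IntrinsicRecipe.hloc_of_characteristic_then_singularPoints K X f ι hι 𝔭 h𝔭0 hs hregB K' 𝔔' h𝔔'𝔭 J₁ hn hJ₁top hchar hZc hpt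
    hloc

end Summit.ResolutionOfSingularities.ResolutionOfSingularities.Theorems.FRationalResolution.IntrinsicRecipeGlobal

end
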